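import Literature.Geometry.Kaehler.ComplexTorusLefschetzGroupMatrixUnitFamilyConnected
import Literature.Geometry.Kaehler.ComplexTorusSiegelLeviConnected
import HarnessLib

/-!
# A complete family of PAIRED `d × d` matrix-unit systems in `End_ℚ(X) ⊗ ℂ` whose adjoint involution SWAPS the
# two members of each pair (and transposes) makes `S(X)(ℂ) = P · Δ_d(∏_w U_w(ℂ)) · P⁻¹`, `U_w ≅ GL`, irreducible:
# `Lf(X)(ℂ) = S(X)(ℂ)` (the engine of Milne 1999, §2, «simple abelian variety of type IV» / Remark 2.2,
# Summary table «IV ∣ GL ∣ Connected: Yes»)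

Layer `Literature/Geometry/Kaehler`, namespace `Literature.Geometry.Kaehler.ComplexTorus`; lane `lit-hodgefound`
(Track 2 foundations library), Layer A4 (Lefschetz groups), GAP row **A4-90 (type IV, every degree `d ≥ 1`)** of
`run/shared/lean/pub/lit-hodgefound/SKELETON.md` (filed by `lit-hodgefound-skel-4`), FILE 1 of 2: the pure matrix
algebra.  The PAIR analogue, BY NAME, of `ComplexTorusLefschetzGroupMatrixUnitFamilyConnected` (A4-90 type II FILE 1:
ONE system per place, transpose-type adjoints, blocks `Sp`); it rests on skel-4's `ComplexTorusSiegelLeviConnected`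
(A4-94 (a): `exists_subgroup_unitaryPair` — for `H` alternating invertible on `l ⊕ l` with `H|V₁×V₁ = 0 = H|V₂×V₂`,
`{N ∈ SL_{2l}(ℂ) ∣ ᵗNHN = H, N(V₁) ⊆ V₁, N(V₂) ⊆ V₂} = Q·{diag(g, ᵗg⁻¹)}·Q⁻¹ ≅ GL_l(ℂ)` is Zariski-closed with prime
vanishing ideal, Milne's Remark 2.2), on `ComplexTorusLefschetzGroupPowerIdentityComponent` (`diagPowSLC`,
`mem_map_diagPowSLC_iff`, `isPrime_vanishingIdealC_map_diagPowSLC`, `one_kronecker_injective`, `det_one_kronecker`),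
`ComplexTorusLefschetzGroupSigmaPiIdentityComponent` (`isPrime_vanishingIdealC_sigmaPi_map`), `ComplexTorusHodgeGroupSigmaPi`
(`sigmaBlockDiagSL`, `eq_blockDiagonal'_blockDiag'_of_apply_eq_zero`, `isUnit_det_of_isUnit_det_blockDiagonal'`),
`ComplexTorusSymplecticGroupGramConnected` (`reindexSLC`, `conjGLC` and their primality / closedness transports),
`ComplexTorusRealMultiplicationLefschetzGroupConnected` (`conj_symplectic_iff`), `ComplexTorusLefschetzGroupIdentityComponent`
(`lefschetzGroupC`, `mem_lefschetzGroupC_iff`, `lefschetzIdentityC_eq_of_isPrime`) and `ComplexTorusRosati` (`rosati`,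
`mul_rosati`).  THEOREMS ONLY (no definition, no instance, no notation, no named fact; D-0026, net debt 0); helpers are
private.  FILE 2 produces the family for a simple polarised torus of Albert type IV from Lange's real structure
`ℝ ⊗ End_ℚ(X) ≃ ∏_w M_d(ℂ)` (`′ ↦` conjugate transpose; p12's `IsSimple.exists_algEquiv_pi_matrix_star_of_isAlbertTypeIV`).

## Sources, verbatim

* J. S. Milne, *Lefschetz classes on abelian varieties*, Duke Math. J. **96** (1999) 639–675 (held
  `paper:doi-10-1215-s0012-7094-99-09620-5`, PDF page = printed page − 638). §2, Remark 2.2 (p. 647–648, p0009 L40 –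
  p0010 L12): «let `V₀` be a free `E ⊗_{k₀} Ω`-module […] `φ₀ : V₀ × V₀ → E ⊗_{k₀} Ω` be a nondegenerate skew-Hermitian
  form. Then […] `V₀ = V₁ ⊕ V₂` […] `φ` is zero on `V₁` and `V₂` […] The map `α ↦ α|V₁ : U(φ₀)_Ω → GL(V₁)` is an
  isomorphism»; p. 651 (p0013 L8–L30), «*Simple abelian variety of type IV.* […] for each homomorphism `σ : F → k^al`
  […] `E ⊗_{F,σ} k^al ≈ M_d(k^al) × M_d(k^al)` […] `S(A)_{/k^al} ≅ ∏ GL`»; p. 652 (p0014), Summary table: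
  «IV ∣ GL ∣ Semisimple: No ∣ Connected: Yes».
* H. Lange, *Abelian Varieties over the Complex Numbers* (2023), §2.6.1 / Thm. 2.6.5 (type IV:
  `End_ℚ(X) ⊗ ℝ ≃ ∏ M_d(ℂ)`, the Rosati involution ↦ `ᵗx̄`); §7.2.4 Exercise (4) (`Lf(X)`).
* T. A. Springer, *Linear Algebraic Groups*, 2nd ed. (1998): Exercise 2.2.2 (1) (`GL_n` connected), Thm. 1.5.4 (ii),
  Prop. 2.2.1.

## The mechanism, and what is proved (pure matrix algebra over `ℂ`; CONCRETE torus level `X = E/Φ(ℤ^ι)`)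

DATA of `isPrime_vanishingIdealC_lefschetzGroupC_of_matrixUnitPairFamily`: a rational `G` with `det G ≠ 0`,
`ᵗG = −G`; a finite type `W` («the embeddings `σ : F → k^al` of the totally real subfield», equivalently the conjugate
pairs of embeddings of the CM centre), `d ≥ 1`, and `e : W → Fin 2 → Fin d → Fin d → M_ι(ℂ)` — for each `w` TWO
`d × d` matrix-unit systems `e w 0 · ·`, `e w 1 · ·` («`E ⊗_{F,σ} k^al ≈ M_d(k^al) × M_d(k^al)`») — with (i) the table
`e w s a b · e w' s' c d = δ_{ww'} δ_{ss'} δ_{bc} e w s a d`, (ii) COMPLETENESS `Σ_w Σ_s Σ_a e w s a a = 1`, (iii) the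
units and `End_ℚ(X) ⊗ 1` spanning the same `ℂ`-subspace, (iv) the adjoint involution `A† = G_ℂ⁻¹ ᵗA G_ℂ` (`rosati`)
SWAPPING the pair and transposing: `(e w s a b)† = e w s̄ b a` (`s̄ = Fin.rev s`; conjugate transposition exchanges the
two complex embeddings over a real place).
* §1 Kronecker bookkeeping on `Fin d × S` (a matrix commuting with every `E_{ab} ⊗ 1` is `1_d ⊗ C`).
* §2 THE PAIRED FRAME (`exists_framePair`).  The corners `V_{w,s} = e w s 0 0 · ℂ^ι` of a pair are PERFECTLY PAIRED
  by `G_ℂ` (`ᵗ(e w s 0 0) G_ℂ = G_ℂ · e w s̄ 0 0`, Milne's «`φ₁ : V₁ × V₂ → Ω` nondegenerate»), hence have the same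
  dimension `m w` (injections into duals); with bases `v w s x` (`x : Fin (m w)`) the vectors
  `u(a, w, s, x) = e w s a 0 · v w s x` form a basis of `ℂ^ι` indexed by `Fin d × Σ_w (Fin 2 × Fin (m w)) ≃ ι`, and in
  this frame `P`, `e w s a b = P (E_{ab} ⊗ Π_{w,s}) P⁻¹` (`Π_{w,s}` the diagonal projector onto block `(w,s)`).
* §3 THE MAIN THEOREM.  In the frame an element of `S(X)(ℂ)` is `P (1_d ⊗ diag_w C_w) P⁻¹` with `C_w` preserving
  `V_{w,0}` and `V_{w,1}` and `ᵗC_w H_w C_w = H_w` for the alternating invertible pair Gram matrix `H_w`, which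
  VANISHES on `V_{w,0} × V_{w,0}` and `V_{w,1} × V_{w,1}`; so **`S(X)(ℂ) = P · Δ_d(∏_w U_w) · P⁻¹`** with `U_w` skel-4's
  unitary-pair group (`≅ GL_{m w}(ℂ)`, «`α ↦ α|V₁` is an isomorphism»), assembled by `Subgroup.pi` → `sigmaBlockDiagSL`
  → `diagPowSLC _ d` → `reindexSLC` → `conjGLC` — EXPORTED with its data (`m`, the relabelling, `P`, the pair Gram
  matrices `H_w`, the groups `U_w` by their membership condition, the units in the frame) as
  **`exists_frame_lefschetzGroupC_eq_conj_diagPow_pi_of_matrixUnitPairFamily`** (the «Group» column of type IV in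
  coordinates; added in generation 61 of seat p17 by splitting the original proof, statements below unchanged) —, and
  primality of the complex vanishing ideal is transported:
  **`isPrime_vanishingIdealC_lefschetzGroupC_of_matrixUnitPairFamily`**, and
  **`lefschetzIdentityC_eq_lefschetzGroupC_of_matrixUnitPairFamily`** (`Lf(X)(ℂ) = S(X)(ℂ)`: «Connected: Yes»).

Faithfulness notes. (i) As everywhere in this lane, Milne's algebraic group `S(A)` enters through its complex points
and «connected» is `S(X)(ℂ)⁰ = S(X)(ℂ)` (prime complex vanishing ideal).  (ii) Milne phrases type IV through the
skew-Hermitian form `φ₀` over `E ⊗ k^al` and Remark 2.2; here the splitting `V_σ = V₁ ⊕ V₂` is produced by the two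
matrix-unit systems of a pair and the vanishing of `φ` on `V₁`, `V₂` by the swap in (iv).  (iii) Nothing is claimed
about real points, `dim` or `rank`.

## References

* [Milne1999LefschetzClasses] J. S. Milne, *Lefschetz classes on abelian varieties*, Duke Math. J. 96 (1999)
  639–675: §2, Remark 2.2 (p. 647–648), «Simple abelian variety of type IV» (p. 651), Summary table (p. 652).
* [Lange2023AbelianVarietiesComplex] H. Lange, *Abelian Varieties over the Complex Numbers* (2023), §2.6.1,
  Thm. 2.6.5, §7.2.4 Exercise (4).
* [Springer1998] T. A. Springer, *Linear Algebraic Groups*, 2nd ed. (1998), Exercise 2.2.2 (1), Thm. 1.5.4 (ii),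
  Prop. 2.2.1.
-/

noncomputable section

open Matrix Module
open scoped Kronecker

namespace Literature.Geometry.Kaehler

namespace ComplexTorus

/-! ## §1 Kronecker bookkeeping on `Fin d × S` -/

section KroneckerDeg

variable {S : Type*} [Fintype S] [DecidableEq S] {d : ℕ}

omit [Fintype S] in
/-- Entries of `E_{ab} ⊗ diag(f)`. [folklore] -/
private theorem single_kronecker_diagonal_apply_deg (a b c c' : Fin d) (f : S → ℂ) (p q : S) :
    (Matrix.single a b (1 : ℂ) ⊗ₖ Matrix.diagonal f) (c, p) (c', q) =
      if a = c ∧ b = c' ∧ p = q then f p else 0 := by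
  rw [Matrix.kronecker_apply, Matrix.single, Matrix.of_apply, Matrix.diagonal_apply]
  by_cases h1 : a = c ∧ b = c'
  · by_cases h2 : p = q
    · rw [if_pos h1, if_pos h2, if_pos ⟨h1.1, h1.2, h2⟩, one_mul]
    · rw [if_neg h2, mul_zero, if_neg fun h ↦ h2 h.2.2]
  · rw [if_neg h1, zero_mul, if_neg fun h ↦ h1 ⟨h.1, h.2.1⟩]

omit [Fintype S] [DecidableEq S] in
/-- Entries of `1_d ⊗ C`. [folklore] -/
private theorem one_kronecker_apply_deg (C : Matrix S S ℂ) (c c' : Fin d) (p q : S) :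
    ((1 : Matrix (Fin d) (Fin d) ℂ) ⊗ₖ C) (c, p) (c', q) = if c = c' then C p q else 0 := by
  rw [Matrix.kronecker_apply, Matrix.one_apply]
  split_ifs
  · rw [one_mul]
  · rw [zero_mul]

omit [Fintype S] [DecidableEq S] in
/-- `A ⊗ (Σ_w X_w) = Σ_w A ⊗ X_w`. [folklore] -/
private theorem kronecker_sum_deg {W : Type*} (s : Finset W) (A : Matrix (Fin d) (Fin d) ℂ) (X : W → Matrix S S ℂ) :
    A ⊗ₖ (∑ w ∈ s, X w) = ∑ w ∈ s, A ⊗ₖ X w := by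
  ext ⟨c, p⟩ ⟨c', q⟩
  simp only [Matrix.kronecker_apply, Matrix.sum_apply, Finset.mul_sum]

/-- **A matrix on `ℂ^d ⊗ ℂ^S` commuting with every `E_{ab} ⊗ 1` is `1_d ⊗ C`** (`C` its `(0,0)` block).
[cite: Milne1999LefschetzClasses, §2 («`V_σ` … standard representation»)] -/
private theorem eq_one_kronecker_of_commute_single_kronecker_deg [NeZero d] {B : Matrix (Fin d × S) (Fin d × S) ℂ}
    (h : ∀ a b : Fin d, B * (Matrix.single a b (1 : ℂ) ⊗ₖ (1 : Matrix S S ℂ)) =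
      (Matrix.single a b (1 : ℂ) ⊗ₖ (1 : Matrix S S ℂ)) * B) :
    B = (1 : Matrix (Fin d) (Fin d) ℂ) ⊗ₖ B.submatrix (Prod.mk 0) (Prod.mk 0) := by
  have hL : ∀ (a b : Fin d) (c : Fin d) (p : S) (c' : Fin d) (q : S),
      (B * (Matrix.single a b (1 : ℂ) ⊗ₖ (1 : Matrix S S ℂ))) (c, p) (c', q) =
        if b = c' then B (c, p) (a, q) else 0 := by
    intro a b c p c' q
    rw [Matrix.mul_apply, Fintype.sum_prod_type]
    have hdiag : (1 : Matrix S S ℂ) = Matrix.diagonal fun _ ↦ (1 : ℂ) := rfl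
    simp_rw [hdiag, single_kronecker_diagonal_apply_deg, mul_ite, mul_one, mul_zero]
    by_cases hbd : b = c'
    · rw [if_pos hbd, Finset.sum_eq_single a (fun a' _ ha' ↦ by
          rw [Finset.sum_eq_zero]; intro x _; rw [if_neg]; exact fun hh ↦ ha' hh.1.symm)
        (fun ha ↦ (ha (Finset.mem_univ a)).elim)]
      rw [Finset.sum_eq_single q (fun x _ hx ↦ by rw [if_neg]; exact fun hh ↦ hx hh.2.2)
        (fun hq ↦ (hq (Finset.mem_univ q)).elim), if_pos ⟨rfl, hbd, rfl⟩]
    · rw [if_neg hbd]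
      exact Finset.sum_eq_zero fun x _ ↦ Finset.sum_eq_zero fun y _ ↦ by rw [if_neg]; exact fun hh ↦ hbd hh.2.1
  have hR : ∀ (a b : Fin d) (c : Fin d) (p : S) (c' : Fin d) (q : S),
      ((Matrix.single a b (1 : ℂ) ⊗ₖ (1 : Matrix S S ℂ)) * B) (c, p) (c', q) =
        if a = c then B (b, p) (c', q) else 0 := by
    intro a b c p c' q
    rw [Matrix.mul_apply, Fintype.sum_prod_type]
    have hdiag : (1 : Matrix S S ℂ) = Matrix.diagonal fun _ ↦ (1 : ℂ) := rfl
    simp_rw [hdiag, single_kronecker_diagonal_apply_deg, ite_mul, one_mul, zero_mul]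
    by_cases hac : a = c
    · rw [if_pos hac, Finset.sum_eq_single b (fun b' _ hb' ↦ by
          rw [Finset.sum_eq_zero]; intro x _; rw [if_neg]; exact fun hh ↦ hb' hh.2.1.symm)
        (fun hb ↦ (hb (Finset.mem_univ b)).elim)]
      rw [Finset.sum_eq_single p (fun x _ hx ↦ by rw [if_neg]; exact fun hh ↦ hx hh.2.2.symm)
        (fun hp ↦ (hp (Finset.mem_univ p)).elim), if_pos ⟨hac, rfl, rfl⟩]
    · rw [if_neg hac]
      exact Finset.sum_eq_zero fun x _ ↦ Finset.sum_eq_zero fun y _ ↦ by rw [if_neg]; exact fun hh ↦ hac hh.1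
  ext ⟨c, p⟩ ⟨c', q⟩
  rw [one_kronecker_apply_deg, Matrix.submatrix_apply]
  by_cases hcd : c = c'
  · subst hcd
    rw [if_pos rfl]
    have h2 := congrFun (congrFun (h c 0) (c, p)) (0, q)
    rw [hL, hR, if_pos rfl, if_pos rfl] at h2
    exact h2
  · rw [if_neg hcd]
    have h3 := congrFun (congrFun (h c' c') (c, p)) (c', q)
    rw [hL, hR, if_pos rfl, if_neg (Ne.symm hcd)] at h3
    exact h3

end KroneckerDeg

/-! ## §2 The paired frame -/

section FramePair

variable {ι : Type*} [Fintype ι] [DecidableEq ι] {W : Type*} [Fintype W] [DecidableEq W] {d : ℕ}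

omit [DecidableEq ι] [Fintype W] [DecidableEq W] in
/-- `(A x) · Γ y = x · (ᵗA Γ) y`. [folklore] -/
private theorem mulVec_dotProduct_mulVec_pair (A Γ : Matrix ι ι ℂ) (x y : ι → ℂ) :
    A *ᵥ x ⬝ᵥ Γ *ᵥ y = x ⬝ᵥ (Aᵀ * Γ) *ᵥ y := by
  rw [← Matrix.vecMul_transpose, ← Matrix.dotProduct_mulVec, Matrix.mulVec_mulVec]

omit [Fintype W] [DecidableEq W] in
/-- A subspace that pairs non-degenerately (on the left) into another has at most its dimension: the map into the
dual is injective. [folklore] -/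
private theorem finrank_le_of_pairing {V₀ V₁ : Submodule ℂ (ι → ℂ)} (Γ : Matrix ι ι ℂ)
    (h : ∀ x ∈ V₀, (∀ y ∈ V₁, x ⬝ᵥ Γ *ᵥ y = 0) → x = 0) : finrank ℂ V₀ ≤ finrank ℂ V₁ := by
  let f : V₀ →ₗ[ℂ] Module.Dual ℂ V₁ := (V₁.dualRestrict ∘ₗ Matrix.toLinearMap₂' ℂ Γ) ∘ₗ V₀.subtype
  have hf : Function.Injective f := by
    rw [← LinearMap.ker_eq_bot, LinearMap.ker_eq_bot']
    intro x hx
    refine Subtype.ext (h x x.2 fun y hy ↦ ?_)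
    have h1 := LinearMap.congr_fun hx ⟨y, hy⟩
    rw [LinearMap.zero_apply] at h1
    rw [← h1]
    change _ = (V₁.dualRestrict (Matrix.toLinearMap₂' ℂ Γ (x : ι → ℂ))) ⟨y, hy⟩
    rw [Submodule.dualRestrict_apply, Matrix.toLinearMap₂'_apply']
  have h2 := LinearMap.finrank_le_finrank_of_injective hf
  rwa [Subspace.dual_finrank_eq] at h2

omit [Fintype W] [DecidableEq W] in
/-- `(∀ z, x · Γ z = 0) ⟹ x = 0` for `Γ` invertible. [folklore] -/
private theorem eq_zero_of_forall_dotProduct_mulVec_eq_zero {Γ : Matrix ι ι ℂ} (hΓ : IsUnit Γ.det) {x : ι → ℂ}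
    (h : ∀ z, x ⬝ᵥ Γ *ᵥ z = 0) : x = 0 := by
  have h1 : x ᵥ* Γ = 0 := by
    funext i
    have h2 := h (Pi.single i 1)
    rwa [Matrix.dotProduct_mulVec, dotProduct_single, mul_one] at h2
  have h3 : x ᵥ* Γ ᵥ* Γ⁻¹ = 0 := by rw [h1, Matrix.zero_vecMul]
  rwa [Matrix.vecMul_vecMul, Matrix.mul_nonsing_inv _ hΓ, Matrix.vecMul_one] at h3

/-- **The paired frame.**  For a complete family of pairwise orthogonal `d × d` matrix-unit systems `e w s a b`
(`s : Fin 2`) whose adjoints swap each pair, `ᵗ(e w s a b) Γ = Γ (e w s̄ b a)`, with `Γ` invertible: the two corners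
`V_{w,0} = e w 0 0 0 · ℂ^ι`, `V_{w,1} = e w 1 0 0 · ℂ^ι` of a pair are perfectly paired by `Γ` and have a common
dimension `m w`; there are bases `v w s x` (`x : Fin (m w)`) of the corners and an invertible `P` whose columns, indexed
through `Fin d × Σ_w (Fin 2 × Fin (m w)) ≃ ι`, are the vectors `e w s a 0 · v w s x` (Milne, Remark 2.2:
«`V₀ = V₁ ⊕ V₂`», for all `σ` at once). [cite: Milne1999LefschetzClasses, §2 Remark 2.2 and type IV (p. 651)] -/
private theorem exists_framePair [NeZero d] {Γ : Matrix ι ι ℂ} (hΓu : IsUnit Γ.det)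
    {e : W → Fin 2 → Fin d → Fin d → Matrix ι ι ℂ}
    (hmul : ∀ (w w' : W) (s s' : Fin 2) (a b c d' : Fin d),
      e w s a b * e w' s' c d' = if w = w' ∧ s = s' ∧ b = c then e w s a d' else 0)
    (hone : ∑ w, ∑ s, ∑ a, e w s a a = 1) (hadjΓ : ∀ w s a b, (e w s a b)ᵀ * Γ = Γ * e w s.rev b a) :
    ∃ (m : W → ℕ) (v : ∀ w, Fin 2 → Fin (m w) → ι → ℂ) (eι : (Fin d × Σ w, Fin 2 × Fin (m w)) ≃ ι)
      (P : Matrix ι ι ℂ), IsUnit P.det ∧ (∀ w s x, e w s 0 0 *ᵥ v w s x = v w s x) ∧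
      ∀ k, (fun i ↦ P i k) =
        e (eι.symm k).2.1 (eι.symm k).2.2.1 (eι.symm k).1 0 *ᵥ v (eι.symm k).2.1 (eι.symm k).2.2.1 (eι.symm k).2.2.2 := by
  classical
  -- the corners
  let V : W → Fin 2 → Submodule ℂ (ι → ℂ) := fun w s ↦ LinearMap.range (Matrix.toLin' (e w s 0 0))
  have hmemV : ∀ (w : W) (s : Fin 2) (a : Fin d) (y : ι → ℂ), e w s 0 a *ᵥ y ∈ V w s := fun w s a y ↦
    ⟨e w s 0 a *ᵥ y, by rw [Matrix.toLin'_apply, Matrix.mulVec_mulVec, hmul, if_pos ⟨rfl, rfl, rfl⟩]⟩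
  have hVfix : ∀ w s, ∀ y ∈ V w s, e w s 0 0 *ᵥ y = y := by
    rintro w s _ ⟨z, rfl⟩
    rw [Matrix.toLin'_apply, Matrix.mulVec_mulVec, hmul, if_pos ⟨rfl, rfl, rfl⟩]
  -- the corners of a pair are perfectly paired: equal dimensions
  have hpair : ∀ w s, ∀ x ∈ V w s, (∀ y ∈ V w s.rev, x ⬝ᵥ Γ *ᵥ y = 0) → x = 0 := by
    intro w s x hx h0
    refine eq_zero_of_forall_dotProduct_mulVec_eq_zero hΓu fun z ↦ ?_
    rw [← hVfix w s x hx, mulVec_dotProduct_mulVec_pair, hadjΓ, ← Matrix.mulVec_mulVec]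
    exact h0 _ (hmemV w s.rev 0 z)
  have hle : ∀ w s, finrank ℂ (V w s) ≤ finrank ℂ (V w s.rev) := fun w s ↦ finrank_le_of_pairing Γ (hpair w s)
  let m : W → ℕ := fun w ↦ finrank ℂ (V w 0)
  have hm : ∀ w s, finrank ℂ (V w s) = m w := by
    intro w s
    fin_cases s
    · rfl
    · exact le_antisymm (hle w 1) (hle w 0)
  -- bases of the corners
  let bw : ∀ w s, Module.Basis (Fin (m w)) ℂ (V w s) := fun w s ↦ Module.finBasisOfFinrankEq ℂ (V w s) (hm w s)
  let v : ∀ w, Fin 2 → Fin (m w) → ι → ℂ := fun w s x ↦ ((bw w s x : V w s) : ι → ℂ)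
  have hvw : ∀ w s x, v w s x = ((bw w s x : V w s) : ι → ℂ) := fun w s x ↦ rfl
  have hv : ∀ w s x, e w s 0 0 *ᵥ v w s x = v w s x := fun w s x ↦ hVfix w s _ (bw w s x).2
  -- the frame vectors and the action of the units on them
  let u : (Fin d × Σ w, Fin 2 × Fin (m w)) → ι → ℂ := fun r ↦ e r.2.1 r.2.2.1 r.1 0 *ᵥ v r.2.1 r.2.2.1 r.2.2.2
  have hu : ∀ r : Fin d × Σ w, Fin 2 × Fin (m w), u r = e r.2.1 r.2.2.1 r.1 0 *ᵥ v r.2.1 r.2.2.1 r.2.2.2 :=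
    fun r ↦ rfl
  have hact : ∀ (w : W) (s : Fin 2) (a b : Fin d) (r : Fin d × Σ w, Fin 2 × Fin (m w)),
      e w s a b *ᵥ u r = if w = r.2.1 ∧ s = r.2.2.1 ∧ b = r.1 then e w s a 0 *ᵥ v r.2.1 r.2.2.1 r.2.2.2 else 0 := by
    intro w s a b r
    rw [hu, Matrix.mulVec_mulVec, hmul]
    split_ifs
    · rfl
    · rw [Matrix.zero_mulVec]
  -- coordinate functionals dual to the frame vectors
  have hproj : ∀ r₀ : Fin d × Σ w, Fin 2 × Fin (m w), ∃ π : (ι → ℂ) →ₗ[ℂ] ℂ, ∀ r, π (u r) = if r = r₀ then 1 else 0 := by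
    rintro ⟨a₀, w₀, s₀, x₀⟩
    refine ⟨((bw w₀ s₀).coord x₀) ∘ₗ LinearMap.codRestrict (V w₀ s₀) (Matrix.toLin' (e w₀ s₀ 0 a₀))
      (fun y ↦ by rw [Matrix.toLin'_apply]; exact hmemV w₀ s₀ a₀ y), fun r ↦ ?_⟩
    obtain ⟨c, w, s, x⟩ := r
    have hval : e w₀ s₀ 0 a₀ *ᵥ u (c, ⟨w, s, x⟩) = if w₀ = w ∧ s₀ = s ∧ a₀ = c then v w s x else 0 := by
      rw [hact]
      by_cases h : w₀ = w ∧ s₀ = s ∧ a₀ = c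
      · obtain ⟨rfl, rfl, rfl⟩ := h
        rw [if_pos ⟨rfl, rfl, rfl⟩, if_pos ⟨rfl, rfl, rfl⟩]
        exact hv _ _ _
      · rw [if_neg h, if_neg h]
    rw [LinearMap.comp_apply]
    by_cases h : w₀ = w ∧ s₀ = s ∧ a₀ = c
    · obtain ⟨rfl, rfl, rfl⟩ := h
      have hx : LinearMap.codRestrict (V w₀ s₀) (Matrix.toLin' (e w₀ s₀ 0 a₀))
          (fun y ↦ by rw [Matrix.toLin'_apply]; exact hmemV w₀ s₀ a₀ y) (u (a₀, ⟨w₀, s₀, x⟩)) = bw w₀ s₀ x :=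
        Subtype.ext (by rw [LinearMap.codRestrict_apply, Matrix.toLin'_apply, hval, if_pos ⟨rfl, rfl, rfl⟩, hvw])
      rw [hx, Module.Basis.coord_apply, Module.Basis.repr_self, Finsupp.single_apply]
      by_cases hxx : x = x₀
      · subst hxx
        rw [if_pos rfl, if_pos rfl]
      · rw [if_neg hxx, if_neg]
        intro H
        rw [Prod.mk.injEq, Sigma.mk.inj_iff] at H
        obtain ⟨-, -, H2⟩ := H
        rw [heq_eq_eq, Prod.mk.injEq] at H2
        exact hxx H2.2
    · have hx : LinearMap.codRestrict (V w₀ s₀) (Matrix.toLin' (e w₀ s₀ 0 a₀))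
          (fun y ↦ by rw [Matrix.toLin'_apply]; exact hmemV w₀ s₀ a₀ y) (u (c, ⟨w, s, x⟩)) = 0 :=
        Subtype.ext (by rw [LinearMap.codRestrict_apply, Matrix.toLin'_apply, hval, if_neg h]; rfl)
      rw [hx, map_zero, if_neg]
      intro H
      rw [Prod.mk.injEq, Sigma.mk.inj_iff] at H
      obtain ⟨H1, H2, H3⟩ := H
      subst H2
      rw [heq_eq_eq, Prod.mk.injEq] at H3
      exact h ⟨rfl, H3.1.symm, H1.symm⟩
  choose π hπ using hproj
  -- linear independence
  have hli : LinearIndependent ℂ u := by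
    rw [linearIndependent_iff']
    intro s g hg r hr
    have h := congrArg (π r) hg
    rw [map_sum, map_zero] at h
    simp_rw [map_smul, hπ r, smul_eq_mul, mul_ite, mul_one, mul_zero] at h
    rwa [Finset.sum_ite_eq' s r, if_pos hr] at h
  -- generation: `y = Σ_w Σ_s Σ_a e w s a 0 (e w s 0 a y)` and `e w s 0 a y ∈ V_{w,s}`
  have hsp : ⊤ ≤ Submodule.span ℂ (Set.range u) := by
    intro y _
    have hy : y = ∑ w, ∑ s, ∑ a, e w s a a *ᵥ y := by
      have h1 := congrArg (fun X : Matrix ι ι ℂ ↦ X *ᵥ y) hone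
      simp only [Matrix.sum_mulVec, Matrix.one_mulVec] at h1
      exact h1.symm
    have key : ∀ (w : W) (s : Fin 2) (a : Fin d), e w s a a *ᵥ y ∈ Submodule.span ℂ (Set.range u) := by
      intro w s a
      have hsplit : e w s a a *ᵥ y = e w s a 0 *ᵥ (e w s 0 a *ᵥ y) := by
        rw [Matrix.mulVec_mulVec, hmul, if_pos ⟨rfl, rfl, rfl⟩]
      have hz : e w s 0 a *ᵥ y = ∑ x, (bw w s).repr ⟨_, hmemV w s a y⟩ x • v w s x := by
        have h1 := congrArg Subtype.val ((bw w s).sum_repr ⟨_, hmemV w s a y⟩)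
        rw [Submodule.coe_sum] at h1
        simp only [Submodule.coe_smul] at h1
        exact h1.symm
      rw [hsplit, hz, Matrix.mulVec_sum]
      refine Submodule.sum_mem _ fun x _ ↦ ?_
      rw [Matrix.mulVec_smul]
      exact Submodule.smul_mem _ _ (Submodule.subset_span ⟨(a, ⟨w, s, x⟩), rfl⟩)
    rw [hy]
    exact Submodule.sum_mem _ fun w _ ↦ Submodule.sum_mem _ fun s _ ↦ Submodule.sum_mem _ fun a _ ↦ key w s a
  -- the basis, its index bijection, and the frame matrix
  let B : Module.Basis (Fin d × Σ w, Fin 2 × Fin (m w)) ℂ (ι → ℂ) := Module.Basis.mk hli hsp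
  have hB : ∀ r, B r = u r := fun r ↦ Module.Basis.mk_apply hli hsp r
  let eι : (Fin d × Σ w, Fin 2 × Fin (m w)) ≃ ι := B.indexEquiv (Pi.basisFun ℂ ι)
  let bι : Module.Basis ι ℂ (ι → ℂ) := B.reindex eι
  have hbι : ∀ k, bι k = u (eι.symm k) := fun k ↦ by rw [Module.Basis.reindex_apply, hB]
  refine ⟨m, v, eι, (Pi.basisFun ℂ ι).toMatrix bι,
    Matrix.isUnit_det_of_right_inverse (Module.Basis.toMatrix_mul_toMatrix_flip _ _), hv, fun k ↦ ?_⟩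
  funext i
  rw [Module.Basis.toMatrix_apply, Pi.basisFun_repr, hbι]

end FramePair

/-! ## §3 `S(X)(ℂ) = P · Δ_d(∏_w U_w) · P⁻¹` is irreducible: `Lf(X)(ℂ) = S(X)(ℂ)` -/

section MainPair

variable {ι : Type*} [Fintype ι] [DecidableEq ι] {E : Type*} [NormedAddCommGroup E] [NormedSpace ℂ E]
  (Φ : (ι → ℝ) ≃L[ℝ] E)

/-- `det (G ⊗ 1) ≠ 0`. [folklore] -/
private theorem isUnit_det_map_algebraMap_mp {G : Matrix ι ι ℚ} (hGu : IsUnit G.det) :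
    IsUnit (G.map (algebraMap ℚ ℂ)).det := by
  rw [show G.map (algebraMap ℚ ℂ) = (algebraMap ℚ ℂ).mapMatrix G from rfl, ← RingHom.map_det]
  exact hGu.map _

omit [Fintype ι] [DecidableEq ι] in
/-- `ᵗ(G ⊗ 1) = -(G ⊗ 1)`. [folklore] -/
private theorem transpose_map_algebraMap_mp {G : Matrix ι ι ℚ} (hGt : Gᵀ = -G) :
    (G.map (algebraMap ℚ ℂ))ᵀ = -G.map (algebraMap ℚ ℂ) := by
  rw [← Matrix.transpose_map, hGt, Matrix.map_neg _ (map_neg (algebraMap ℚ ℂ))]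

omit [DecidableEq ι] in
/-- `(column i of P) · Γ (column j of P) = (ᵗP Γ P)_{ij}`. [folklore] -/
private theorem col_dotProduct_mulVec_col_mp (P Γ : Matrix ι ι ℂ) (i j : ι) :
    (fun k ↦ P k i) ⬝ᵥ (Γ *ᵥ fun k ↦ P k j) = (Pᵀ * Γ * P) i j := by
  simp only [Matrix.mul_apply, Matrix.transpose_apply, dotProduct, Matrix.mulVec, Finset.sum_mul, Finset.mul_sum]
  rw [Finset.sum_comm]
  exact Finset.sum_congr rfl fun a _ ↦ Finset.sum_congr rfl fun c _ ↦ by ring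

/-- Commutation in a frame: `(P B P⁻¹)(P D P⁻¹) = (P D P⁻¹)(P B P⁻¹) ⟺ B D = D B`. [folklore] -/
private theorem conjFrame_mul_comm_iff_mp {P : Matrix ι ι ℂ} (hP : IsUnit P.det) (B D : Matrix ι ι ℂ) :
    P * B * P⁻¹ * (P * D * P⁻¹) = P * D * P⁻¹ * (P * B * P⁻¹) ↔ B * D = D * B := by
  have hl : ∀ X Y : Matrix ι ι ℂ, P * X * P⁻¹ * (P * Y * P⁻¹) = P * (X * Y) * P⁻¹ := fun X Y ↦ by
    rw [show P * X * P⁻¹ * (P * Y * P⁻¹) = P * X * (P⁻¹ * P) * Y * P⁻¹ by simp only [Matrix.mul_assoc],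
      Matrix.nonsing_inv_mul _ hP, Matrix.mul_one, Matrix.mul_assoc P X]
  rw [hl, hl]
  constructor
  · intro h
    have h' := congrArg (fun X ↦ P⁻¹ * X * P) h
    rw [show P⁻¹ * (P * (B * D) * P⁻¹) * P = P⁻¹ * P * (B * D) * (P⁻¹ * P) by simp only [Matrix.mul_assoc],
      show P⁻¹ * (P * (D * B) * P⁻¹) * P = P⁻¹ * P * (D * B) * (P⁻¹ * P) by simp only [Matrix.mul_assoc],
      Matrix.nonsing_inv_mul _ hP, Matrix.one_mul, Matrix.mul_one, Matrix.one_mul, Matrix.mul_one] at h'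
    exact h'
  · intro h
    rw [h]

omit [DecidableEq ι] in
/-- Commutation is preserved under reindexing along a bijection. [folklore] -/
private theorem submatrix_mul_comm_iff_mp {α : Type*} [Fintype α] (eq : α ≃ ι) (X Y : Matrix ι ι ℂ) :
    X.submatrix eq eq * Y.submatrix eq eq = Y.submatrix eq eq * X.submatrix eq eq ↔ X * Y = Y * X := by
  rw [Matrix.submatrix_mul_equiv, Matrix.submatrix_mul_equiv]
  refine ⟨fun h ↦ ?_, fun h ↦ by rw [h]⟩
  have h2 := congrArg (fun Z : Matrix α α ℂ ↦ Z.submatrix eq.symm eq.symm) h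
  simp only [Matrix.submatrix_submatrix, Equiv.self_comp_symm, Matrix.submatrix_id_id] at h2
  exact h2

omit [DecidableEq ι] in
/-- `ᵗX H X = H` is preserved under reindexing along a bijection. [folklore] -/
private theorem submatrix_transpose_mul_mul_iff_mp {α : Type*} [Fintype α] (eq : α ≃ ι) (X H : Matrix ι ι ℂ) :
    (X.submatrix eq eq)ᵀ * H.submatrix eq eq * X.submatrix eq eq = H.submatrix eq eq ↔ Xᵀ * H * X = H := by
  rw [show (X.submatrix ⇑eq ⇑eq)ᵀ = Xᵀ.submatrix eq eq from (Matrix.transpose_submatrix _ _ _).symm,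
    Matrix.submatrix_mul_equiv, Matrix.submatrix_mul_equiv]
  refine ⟨fun h ↦ ?_, fun h ↦ by rw [h]⟩
  have h2 := congrArg (fun Z : Matrix α α ℂ ↦ Z.submatrix eq.symm eq.symm) h
  simp only [Matrix.submatrix_submatrix, Equiv.self_comp_symm, Matrix.submatrix_id_id] at h2
  exact h2

omit [DecidableEq ι] in
/-- A matrix commuting with a set of matrices commutes with their `ℂ`-span. [folklore] -/
private theorem mul_comm_of_mem_span_mp {M : Matrix ι ι ℂ} {s : Set (Matrix ι ι ℂ)} (h : ∀ x ∈ s, M * x = x * M)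
    {φ : Matrix ι ι ℂ} (hφ : φ ∈ Submodule.span ℂ s) : M * φ = φ * M := by
  induction hφ using Submodule.span_induction with
  | mem x hx => exact h x hx
  | zero => rw [mul_zero, zero_mul]
  | add x y _ _ hx hy => rw [mul_add, add_mul, hx, hy]
  | smul c x _ hx => rw [mul_smul_comm, smul_mul_assoc, hx]

/-- `s̄ ≠ s` in `Fin 2`. [folklore] -/
private theorem fin_two_rev_ne (s : Fin 2) : s.rev ≠ s := by
  fin_cases s <;> decide

/-- **THE PAIRED FRAME IDENTITY `S(X)(ℂ) = P · Δ_d(∏_w U_w) · P⁻¹`, EXPORTED WITH ITS DATA** (hypotheses of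
`isPrime_vanishingIdealC_lefschetzGroupC_of_matrixUnitPairFamily` below): there are block sizes `m w`, a relabelling
`eι : Fin d × Σ_w (Fin 2 × Fin (m w)) ≃ ι`, an invertible frame `P` in which every unit is `e w s a b = P (E_{ab} ⊗ Π_{w,s}) P⁻¹`
(`Π_{w,s}` the diagonal projector onto block `(w,s)`), alternating invertible pair Gram matrices `H_w` vanishing on the two
corners `V_{w,0} × V_{w,0}`, `V_{w,1} × V_{w,1}` («`φ|V₁ × V₁ = 0 = φ|V₂ × V₂`»), and the unitary-pair groups
`U_w = {N ∈ SL ∣ ᵗN H_w N = H_w, N(V_{w,s}) ⊆ V_{w,s}}` (Zariski-closed with prime vanishing ideal, `≅ GL_{m_w}(ℂ)`: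
«`α ↦ α|V₁ : U(φ)_Ω → GL(V₁)` is an isomorphism»), such that
`S(X)(ℂ) = P · eι(Δ_d(diag_w U_w)) · P⁻¹` as subgroups of `SL_ι(ℂ)` — Milne's «`S(A)_{/k^al} = ∏ S_σ`,
`S_σ ≈ Aut_{M_d(k^al)}(V₁) ≈ GL_{g/(fd)}(k^al)`» in coordinates, for the «Group» column of type IV.
[cite: Milne1999LefschetzClasses, §2 Remark 2.2 (p. 647–648) and «Simple abelian variety of type IV» (p. 651), Summary table (p. 652: «IV ∣ GL_{g/(df)}»)]
[cite: Lange2023AbelianVarietiesComplex, Thm. 2.6.5 (type IV) and §7.2.4 Exercise (4)] -/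
theorem exists_frame_lefschetzGroupC_eq_conj_diagPow_pi_of_matrixUnitPairFamily {W : Type*} [Fintype W] [DecidableEq W]
    {d : ℕ} [NeZero d] {G : Matrix ι ι ℚ} (hGt : Gᵀ = -G) (hGu : IsUnit G.det)
    {e : W → Fin 2 → Fin d → Fin d → Matrix ι ι ℂ}
    (hmul : ∀ (w w' : W) (s s' : Fin 2) (a b c d' : Fin d),
      e w s a b * e w' s' c d' = if w = w' ∧ s = s' ∧ b = c then e w s a d' else 0)
    (hone : ∑ w, ∑ s, ∑ a, e w s a a = 1)
    (hspan : ∀ w s a b,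
      e w s a b ∈ Submodule.span ℂ ((fun A : Matrix ι ι ℚ ↦ A.map (algebraMap ℚ ℂ)) '' (endAlgRat Φ : Set (Matrix ι ι ℚ))))
    (habs : ∀ A ∈ endAlgRat Φ, A.map (algebraMap ℚ ℂ) ∈
      Submodule.span ℂ (Set.range fun p : W × Fin 2 × Fin d × Fin d ↦ e p.1 p.2.1 p.2.2.1 p.2.2.2))
    (hadj : ∀ w s a b, rosati (G.map (algebraMap ℚ ℂ)) (e w s a b) = e w s.rev b a) :
    ∃ (m : W → ℕ) (eι : (Fin d × Σ w, Fin 2 × Fin (m w)) ≃ ι) (P : Matrix ι ι ℂ) (hP : IsUnit P.det)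
      (Hb : ∀ w, Matrix (Fin 2 × Fin (m w)) (Fin 2 × Fin (m w)) ℂ)
      (K : ∀ w, Subgroup (Matrix.SpecialLinearGroup (Fin 2 × Fin (m w)) ℂ)),
      (∀ w, (Hb w)ᵀ = -Hb w) ∧ (∀ w, IsUnit (Hb w).det) ∧
      (∀ w (t t' : Fin 2 × Fin (m w)), t.1 = t'.1 → Hb w t t' = 0) ∧
      (∀ w (N : Matrix.SpecialLinearGroup (Fin 2 × Fin (m w)) ℂ), N ∈ K w ↔
        N.1ᵀ * Hb w * N.1 = Hb w ∧ ∀ t t' : Fin 2 × Fin (m w), t.1 ≠ t'.1 → N.1 t t' = 0) ∧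
      (∀ w, IsZariskiClosed (K w)) ∧ (∀ w, (vanishingIdealC (K w)).IsPrime) ∧
      (∀ w s a b, e w s a b * P = P * (Matrix.single a b (1 : ℂ) ⊗ₖ Matrix.diagonal
        fun p : Σ w, Fin 2 × Fin (m w) ↦ if p.1 = w ∧ p.2.1 = s then (1 : ℂ) else 0).submatrix eι.symm eι.symm) ∧
      lefschetzGroupC Φ G =
        ((((Subgroup.pi Set.univ K).map (sigmaBlockDiagSL (fun w ↦ Fin 2 × Fin (m w)) ℂ)).map
          (diagPowSLC (Σ w, Fin 2 × Fin (m w)) d)).map (reindexSLC eι).toMonoidHom).map (conjGLC P hP).toMonoidHom := by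
  classical
  set Γ : Matrix ι ι ℂ := G.map (algebraMap ℚ ℂ) with hΓ_def
  have hΓu : IsUnit Γ.det := isUnit_det_map_algebraMap_mp hGu
  have hΓt : Γᵀ = -Γ := transpose_map_algebraMap_mp hGt
  have hadjΓ : ∀ w s a b, (e w s a b)ᵀ * Γ = Γ * e w s.rev b a := fun w s a b ↦ by rw [← mul_rosati hΓu, hadj]
  -- the paired frame
  obtain ⟨m, v, eι, P, hP, hv, hcol⟩ := exists_framePair hΓu hmul hone hadjΓ
  obtain ⟨u, hu⟩ : ∃ u : (Fin d × Σ w, Fin 2 × Fin (m w)) → ι → ℂ,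
      u = fun r ↦ e r.2.1 r.2.2.1 r.1 0 *ᵥ v r.2.1 r.2.2.1 r.2.2.2 := ⟨_, rfl⟩
  have hur : ∀ r : Fin d × Σ w, Fin 2 × Fin (m w), u r = e r.2.1 r.2.2.1 r.1 0 *ᵥ v r.2.1 r.2.2.1 r.2.2.2 :=
    fun r ↦ by rw [hu]
  have hcol' : ∀ k, (fun i ↦ P i k) = u (eι.symm k) := fun k ↦ by rw [hur]; exact hcol k
  have hPik : ∀ i k, P i k = u (eι.symm k) i := fun i k ↦ congrFun (hcol' k) i
  have hXP : ∀ (X : Matrix ι ι ℂ) (i k : ι), (X * P) i k = (X *ᵥ u (eι.symm k)) i := by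
    intro X i k
    simp only [Matrix.mul_apply, Matrix.mulVec, dotProduct, hPik]
  -- the action of the units on the frame vectors
  have hact : ∀ (w : W) (s : Fin 2) (a b : Fin d) (r : Fin d × Σ w, Fin 2 × Fin (m w)),
      e w s a b *ᵥ u r = if w = r.2.1 ∧ s = r.2.2.1 ∧ b = r.1 then u (a, r.2) else 0 := by
    intro w s a b r
    rw [hur, hur, Matrix.mulVec_mulVec, hmul]
    split_ifs with h
    · obtain ⟨rfl, rfl, -⟩ := h
      rfl
    · rw [Matrix.zero_mulVec]
  -- the block projectors `Pw w s` and the normal forms `U w s a b = E_{ab} ⊗ Pw w s` of the units in the frame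
  obtain ⟨Pw, hPw⟩ : ∃ Pw : W → Fin 2 → Matrix (Σ w, Fin 2 × Fin (m w)) (Σ w, Fin 2 × Fin (m w)) ℂ,
      Pw = fun w s ↦ Matrix.diagonal fun p ↦ if p.1 = w ∧ p.2.1 = s then (1 : ℂ) else 0 := ⟨_, rfl⟩
  obtain ⟨U, hU⟩ : ∃ U : W → Fin 2 → Fin d → Fin d →
      Matrix (Fin d × Σ w, Fin 2 × Fin (m w)) (Fin d × Σ w, Fin 2 × Fin (m w)) ℂ,
      U = fun w s a b ↦ Matrix.single a b (1 : ℂ) ⊗ₖ Pw w s := ⟨_, rfl⟩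
  have hUw : ∀ w s a b, U w s a b = Matrix.single a b (1 : ℂ) ⊗ₖ Pw w s := fun w s a b ↦ by rw [hU]
  have hUapply : ∀ (w : W) (s : Fin 2) (a b : Fin d) (r q : Fin d × Σ w, Fin 2 × Fin (m w)),
      U w s a b r q = if a = r.1 ∧ b = q.1 ∧ r.2 = q.2 ∧ q.2.1 = w ∧ q.2.2.1 = s then 1 else 0 := by
    rintro w s a b ⟨c, p⟩ ⟨c', q⟩
    rw [hUw, hPw, single_kronecker_diagonal_apply_deg]
    dsimp only
    by_cases h : a = c ∧ b = c' ∧ p = q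
    · obtain ⟨hac, hbd, hpq⟩ := h
      subst hpq
      rw [if_pos ⟨hac, hbd, rfl⟩]
      by_cases hw : p.1 = w ∧ p.2.1 = s
      · rw [if_pos hw, if_pos ⟨hac, hbd, rfl, hw.1, hw.2⟩]
      · rw [if_neg hw, if_neg fun H ↦ hw ⟨H.2.2.2.1, H.2.2.2.2⟩]
    · rw [if_neg h, if_neg fun H ↦ h ⟨H.1, H.2.1, H.2.2.1⟩]
  have hsumPw : ∑ w, ∑ s, Pw w s = 1 := by
    ext p q
    rw [Matrix.sum_apply, hPw, Matrix.one_apply]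
    simp only [Matrix.sum_apply, Matrix.diagonal_apply]
    by_cases hpq : p = q
    · simp only [if_pos hpq]
      rw [Finset.sum_eq_single p.1 (fun w _ hw ↦ Finset.sum_eq_zero fun s _ ↦ if_neg fun H ↦ hw H.1.symm)
        (fun h ↦ (h (Finset.mem_univ _)).elim),
        Finset.sum_eq_single p.2.1 (fun s _ hs ↦ if_neg fun H ↦ hs H.2.symm) (fun h ↦ (h (Finset.mem_univ _)).elim),
        if_pos ⟨rfl, rfl⟩]
    · simp only [if_neg hpq, Finset.sum_const_zero]
  have hsumU : ∀ a b : Fin d, ∑ w, ∑ s, U w s a b =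
      Matrix.single a b (1 : ℂ) ⊗ₖ (1 : Matrix (Σ w, Fin 2 × Fin (m w)) (Σ w, Fin 2 × Fin (m w)) ℂ) := by
    intro a b
    rw [← hsumPw, kronecker_sum_deg]
    refine Finset.sum_congr rfl fun w _ ↦ ?_
    rw [kronecker_sum_deg]
    exact Finset.sum_congr rfl fun s _ ↦ hUw w s a b
  -- the units in the frame: `e w s a b · P = P · U w s a b`
  have hnf : ∀ w s a b, e w s a b * P = P * (U w s a b).submatrix eι.symm eι.symm := by
    intro w s a b
    ext i k
    rw [hXP, hact, Matrix.mul_apply]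
    have hre : ∑ j, P i j * (U w s a b).submatrix eι.symm eι.symm j k = ∑ r, u r i * U w s a b r (eι.symm k) := by
      rw [← eι.sum_comp]
      refine Finset.sum_congr rfl fun r _ ↦ ?_
      rw [Matrix.submatrix_apply, Equiv.symm_apply_apply, hPik, Equiv.symm_apply_apply]
    rw [hre]
    simp_rw [hUapply]
    by_cases hq : w = (eι.symm k).2.1 ∧ s = (eι.symm k).2.2.1 ∧ b = (eι.symm k).1
    · rw [if_pos hq, Finset.sum_eq_single (a, (eι.symm k).2)]
      · rw [if_pos ⟨rfl, hq.2.2, rfl, hq.1.symm, hq.2.1.symm⟩, mul_one]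
      · intro r _ hr
        rw [if_neg, mul_zero]
        rintro ⟨h1, -, h3, -⟩
        exact hr (Prod.ext h1.symm h3)
      · intro h
        exact (h (Finset.mem_univ _)).elim
    · rw [if_neg hq, Pi.zero_apply]
      refine (Finset.sum_eq_zero fun r _ ↦ ?_).symm
      rw [if_neg, mul_zero]
      rintro ⟨-, h2, -, h4, h5⟩
      exact hq ⟨h4.symm, h5.symm, h2⟩
  -- commuting with `End_ℚ(X) ⊗ 1` is commuting with the units
  have hcommE : ∀ M : Matrix ι ι ℂ,
      (∀ A ∈ endAlgRat Φ, M * A.map (algebraMap ℚ ℂ) = A.map (algebraMap ℚ ℂ) * M) ↔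
        ∀ w s a b, M * e w s a b = e w s a b * M := by
    intro M
    constructor
    · intro h w s a b
      exact mul_comm_of_mem_span_mp (fun x hx ↦ by obtain ⟨A, hA, rfl⟩ := hx; exact h A hA) (hspan w s a b)
    · intro h A hA
      exact mul_comm_of_mem_span_mp (fun x hx ↦ by obtain ⟨p, rfl⟩ := hx; exact h _ _ _ _) (habs A hA)
  -- the corner Gram matrix `Hd`: it pairs block `(w,s)` with block `(w,s̄)` only, and is skew
  obtain ⟨Hd, hHd⟩ : ∃ Hd : Matrix (Σ w, Fin 2 × Fin (m w)) (Σ w, Fin 2 × Fin (m w)) ℂ,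
      Hd = Matrix.of fun p q ↦ v p.1 p.2.1 p.2.2 ⬝ᵥ Γ *ᵥ v q.1 q.2.1 q.2.2 := ⟨_, rfl⟩
  have hHdpq : ∀ p q : Σ w, Fin 2 × Fin (m w), Hd p q = v p.1 p.2.1 p.2.2 ⬝ᵥ Γ *ᵥ v q.1 q.2.1 q.2.2 := fun p q ↦ by
    rw [hHd, Matrix.of_apply]
  have hHd0 : ∀ p q : Σ w, Fin 2 × Fin (m w), ¬(p.1 = q.1 ∧ p.2.1.rev = q.2.1) → Hd p q = 0 := by
    rintro ⟨w, s, x⟩ ⟨w', s', y⟩ hne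
    rw [hHdpq]
    dsimp only at hne ⊢
    rw [← hv w s x, ← hv w' s' y, mulVec_dotProduct_mulVec_pair, hadjΓ, Matrix.mulVec_mulVec, Matrix.mul_assoc, hmul,
      if_neg fun h ↦ hne ⟨h.1, h.2.1⟩, Matrix.mul_zero, Matrix.zero_mulVec, dotProduct_zero]
  have hHdzero : ∀ p q : Σ w, Fin 2 × Fin (m w), p.1 ≠ q.1 → Hd p q = 0 := fun p q hne ↦
    hHd0 p q fun h ↦ hne h.1
  have hHdt : Hdᵀ = -Hd := by
    ext p q
    rw [Matrix.transpose_apply, Matrix.neg_apply, hHdpq, hHdpq, Matrix.dotProduct_mulVec, ← Matrix.mulVec_transpose, hΓt,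
      Matrix.neg_mulVec, neg_dotProduct, dotProduct_comm]
  -- the form on the frame vectors
  have hform : ∀ r q : Fin d × Σ w, Fin 2 × Fin (m w),
      u r ⬝ᵥ Γ *ᵥ u q = if r.1 = q.1 ∧ r.2.1 = q.2.1 ∧ r.2.2.1.rev = q.2.2.1 then Hd r.2 q.2 else 0 := by
    rintro ⟨c, w, s, x⟩ ⟨c', w', s', y⟩
    rw [hur, hur]
    dsimp only
    rw [mulVec_dotProduct_mulVec_pair, hadjΓ, Matrix.mulVec_mulVec, Matrix.mul_assoc, hmul]
    by_cases h : w = w' ∧ s.rev = s' ∧ c = c'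
    · obtain ⟨rfl, rfl, rfl⟩ := h
      rw [if_pos ⟨rfl, rfl, rfl⟩, if_pos ⟨rfl, rfl, rfl⟩, ← Matrix.mulVec_mulVec, hv, hHdpq]
    · rw [if_neg h, if_neg fun h' ↦ h ⟨h'.2.1, h'.2.2, h'.1⟩, Matrix.mul_zero, Matrix.zero_mulVec, dotProduct_zero]
  -- the frame Gram matrix `H = ᵗP Γ P` is `1_d ⊗ Hd` after reindexing
  set H : Matrix ι ι ℂ := Pᵀ * Γ * P with hH_def
  have hHu : IsUnit H.det := by
    rw [hH_def, det_mul, det_mul, det_transpose]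
    exact (hP.mul hΓu).mul hP
  have hHentry : ∀ i j : ι, H i j = u (eι.symm i) ⬝ᵥ Γ *ᵥ u (eι.symm j) := by
    intro i j
    rw [hH_def, ← col_dotProduct_mulVec_col_mp, hcol', hcol']
  have hH' : H.submatrix eι eι = (1 : Matrix (Fin d) (Fin d) ℂ) ⊗ₖ Hd := by
    ext ⟨c, p⟩ ⟨c', q⟩
    rw [Matrix.submatrix_apply, hHentry, Equiv.symm_apply_apply, Equiv.symm_apply_apply, hform, one_kronecker_apply_deg]
    dsimp only
    by_cases hcd : c = c'
    · subst hcd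
      by_cases hpq : p.1 = q.1 ∧ p.2.1.rev = q.2.1
      · rw [if_pos ⟨rfl, hpq.1, hpq.2⟩, if_pos rfl]
      · rw [if_neg fun h ↦ hpq ⟨h.2.1, h.2.2⟩, if_pos rfl, hHd0 p q hpq]
    · rw [if_neg fun h ↦ hcd h.1, if_neg hcd]
  -- the pair blocks of `Hd`: alternating, invertible, zero on each corner
  set Hb : ∀ w, Matrix (Fin 2 × Fin (m w)) (Fin 2 × Fin (m w)) ℂ := fun w ↦ Matrix.blockDiag' Hd w with hHb_def
  have hHdeq : Hd = Matrix.blockDiagonal' Hb := eq_blockDiagonal'_blockDiag'_of_apply_eq_zero hHdzero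
  have hHbt : ∀ w, (Hb w)ᵀ = -Hb w := fun w ↦ by
    ext x y
    have h := congrFun (congrFun hHdt ⟨w, x⟩) ⟨w, y⟩
    rw [transpose_apply, Matrix.neg_apply] at h
    rw [transpose_apply, Matrix.neg_apply]
    exact h
  have hHdu : IsUnit Hd.det := by
    have h1 : IsUnit (H.submatrix eι eι).det := by
      rw [Matrix.det_submatrix_equiv_self]
      exact hHu
    rw [hH', det_one_kronecker] at h1
    exact (isUnit_pow_iff (NeZero.ne d)).1 h1
  have hHbu : ∀ w, IsUnit (Hb w).det := fun w ↦
    isUnit_det_of_isUnit_det_blockDiagonal' (by rw [← hHdeq]; exact hHdu) w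
  have hHbside : ∀ w (t t' : Fin 2 × Fin (m w)), t.1 = t'.1 → Hb w t t' = 0 := by
    intro w t t' htt
    rw [hHb_def]
    dsimp only
    rw [Matrix.blockDiag'_apply]
    exact hHd0 ⟨w, t⟩ ⟨w, t'⟩ fun h ↦ fin_two_rev_ne t.1 (h.2.trans htt.symm)
  -- the pair blocks in `l ⊕ l` coordinates, and skel-4's unitary-pair groups `U_w`
  have hε : ∀ w, ∃ ε : Fin 2 × Fin (m w) ≃ Fin (m w) ⊕ Fin (m w),
      (∀ x, ε.symm (Sum.inl x) = (0, x)) ∧ ∀ x, ε.symm (Sum.inr x) = (1, x) := fun w ↦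
    ⟨(finTwoEquiv.prodCongr (Equiv.refl _)).trans (Equiv.boolProdEquivSum _), fun _ ↦ rfl, fun _ ↦ rfl⟩
  choose ε hεl hεr using hε
  have hKw : ∀ w, ∃ K : Subgroup (Matrix.SpecialLinearGroup (Fin (m w) ⊕ Fin (m w)) ℂ),
      IsZariskiClosed K ∧ (vanishingIdealC K).IsPrime ∧
        ∀ N : Matrix.SpecialLinearGroup (Fin (m w) ⊕ Fin (m w)) ℂ, N ∈ K ↔
          N.1ᵀ * (Hb w).submatrix (ε w).symm (ε w).symm * N.1 = (Hb w).submatrix (ε w).symm (ε w).symm ∧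
            (∀ i j, N.1 (Sum.inl i) (Sum.inr j) = 0) ∧ ∀ i j, N.1 (Sum.inr i) (Sum.inl j) = 0 := by
    intro w
    refine exists_subgroup_unitaryPair ?_ ?_ (fun i j ↦ ?_) (fun i j ↦ ?_)
    · rw [Matrix.transpose_submatrix, hHbt, Matrix.submatrix_neg]
      rfl
    · rw [Matrix.det_submatrix_equiv_self]
      exact hHbu w
    · rw [Matrix.submatrix_apply, hεl, hεl]
      exact hHbside w _ _ rfl
    · rw [Matrix.submatrix_apply, hεr, hεr]
      exact hHbside w _ _ rfl
  choose K' hK'c hK'p hK'mem using hKw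
  let K : ∀ w, Subgroup (Matrix.SpecialLinearGroup (Fin 2 × Fin (m w)) ℂ) := fun w ↦
    (K' w).map (reindexSLC (ε w).symm).toMonoidHom
  have hKc : ∀ w, IsZariskiClosed (K w) := fun w ↦ (hK'c w).map_reindexSLC _
  have hKp : ∀ w, (vanishingIdealC (K w)).IsPrime := fun w ↦ isPrime_vanishingIdealC_map_reindexSLC _ (hK'p w)
  have hKmem : ∀ w (N : Matrix.SpecialLinearGroup (Fin 2 × Fin (m w)) ℂ), N ∈ K w ↔
      N.1ᵀ * Hb w * N.1 = Hb w ∧ ∀ t t' : Fin 2 × Fin (m w), t.1 ≠ t'.1 → N.1 t t' = 0 := by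
    intro w N
    rw [Subgroup.mem_map_equiv, hK'mem, coe_reindexSLC_symm, submatrix_transpose_mul_mul_iff_mp]
    refine and_congr Iff.rfl ⟨fun h ↦ ?_, fun h ↦ ⟨fun i j ↦ ?_, fun i j ↦ ?_⟩⟩
    · rintro ⟨s, x⟩ ⟨s', y⟩ hss
      have h1 := h.1 x y
      have h2 := h.2 x y
      rw [Matrix.submatrix_apply, hεl, hεr] at h1
      rw [Matrix.submatrix_apply, hεr, hεl] at h2
      fin_cases s <;> fin_cases s'
      · exact absurd rfl hss
      · exact h1
      · exact h2
      · exact absurd rfl hss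
    · rw [Matrix.submatrix_apply, hεl, hεr]
      exact h _ _ (show (0 : Fin 2) ≠ 1 by decide)
    · rw [Matrix.submatrix_apply, hεr, hεl]
      exact h _ _ (show (1 : Fin 2) ≠ 0 by decide)
  refine ⟨m, eι, P, hP, Hb, K, hHbt, hHbu, hHbside, hKmem, hKc, hKp, fun w s a b ↦ ?_, ?_⟩
  · simp only [hnf, hUw, hPw]
  -- the identification
  ext M
  rw [Subgroup.mem_map_equiv, Subgroup.mem_map_equiv, mem_lefschetzGroupC_iff, mem_map_diagPowSLC_iff]
  set B : Matrix ι ι ℂ := P⁻¹ * (M : Matrix ι ι ℂ) * P with hB_def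
  have hMB : (M : Matrix ι ι ℂ) = P * B * P⁻¹ := by
    rw [hB_def, show P * (P⁻¹ * (M : Matrix ι ι ℂ) * P) * P⁻¹ = P * P⁻¹ * (M : Matrix ι ι ℂ) * (P * P⁻¹) by
      simp only [Matrix.mul_assoc], Matrix.mul_nonsing_inv _ hP, Matrix.one_mul, Matrix.mul_one]
  have hcoeB' : (((reindexSLC eι).symm ((conjGLC P hP).symm M) :
      Matrix.SpecialLinearGroup (Fin d × Σ w, Fin 2 × Fin (m w)) ℂ) : Matrix _ _ ℂ) = B.submatrix eι eι := by
    rw [coe_reindexSLC_symm, coe_conjGLC_symm]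
  -- (1) the symplectic condition in the frame
  have hsymp_iff : (M : Matrix ι ι ℂ)ᵀ * Γ * (M : Matrix ι ι ℂ) = Γ ↔
      (B.submatrix eι eι)ᵀ * ((1 : Matrix (Fin d) (Fin d) ℂ) ⊗ₖ Hd) * B.submatrix eι eι =
        (1 : Matrix (Fin d) (Fin d) ℂ) ⊗ₖ Hd := by
    rw [hMB, conj_symplectic_iff hP, ← hH_def, ← hH', submatrix_transpose_mul_mul_iff_mp]
  -- (2) commutation with `End_ℚ(X)` in the frame
  have hcomm_iff : (∀ A ∈ endAlgRat Φ, (M : Matrix ι ι ℂ) * A.map (algebraMap ℚ ℂ) = A.map (algebraMap ℚ ℂ) * M) ↔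
      ∀ w s a b, B.submatrix eι eι * U w s a b = U w s a b * B.submatrix eι eι := by
    rw [hcommE]
    refine forall_congr' fun w ↦ forall_congr' fun s ↦ forall_congr' fun a ↦ forall_congr' fun b ↦ ?_
    have he : e w s a b = P * (U w s a b).submatrix eι.symm eι.symm * P⁻¹ := by
      rw [← hnf, Matrix.mul_assoc, Matrix.mul_nonsing_inv _ hP, Matrix.mul_one]
    rw [hMB, he, conjFrame_mul_comm_iff_mp hP, ← submatrix_mul_comm_iff_mp eι]
    simp only [Matrix.submatrix_submatrix, Equiv.symm_comp_self, Matrix.submatrix_id_id]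
  rw [hsymp_iff, hcomm_iff]
  constructor
  · -- `S(X)(ℂ) ⊆ P · Δ_d(∏ U_w) · P⁻¹`
    rintro ⟨hsymp, hcommU⟩
    set B' := B.submatrix eι eι with hB'_def
    -- `B'` commutes with every `E_{ab} ⊗ 1 = Σ_w Σ_s U w s a b`, hence is `1_d ⊗ C`
    have hcomm1 : ∀ a b : Fin d, B' * (Matrix.single a b (1 : ℂ) ⊗ₖ (1 : Matrix _ _ ℂ)) =
        (Matrix.single a b (1 : ℂ) ⊗ₖ (1 : Matrix _ _ ℂ)) * B' := by
      intro a b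
      rw [← hsumU, Finset.mul_sum, Finset.sum_mul]
      refine Finset.sum_congr rfl fun w _ ↦ ?_
      rw [Finset.mul_sum, Finset.sum_mul]
      exact Finset.sum_congr rfl fun s _ ↦ hcommU w s a b
    have hB'eq : B' = (1 : Matrix (Fin d) (Fin d) ℂ) ⊗ₖ B'.submatrix (Prod.mk 0) (Prod.mk 0) :=
      eq_one_kronecker_of_commute_single_kronecker_deg hcomm1
    set C := B'.submatrix (Prod.mk 0) (Prod.mk 0) with hC_def
    -- `C` commutes with the block projectors, hence is block diagonal (over `(w,s)`)
    have hCPw : ∀ w s, C * Pw w s = Pw w s * C := by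
      intro w s
      have h := hcommU w s 0 0
      rw [hB'eq, hUw, ← Matrix.mul_kronecker_mul, ← Matrix.mul_kronecker_mul, Matrix.one_mul, Matrix.mul_one] at h
      ext p q
      have h' := congrFun (congrFun h (0, p)) (0, q)
      rwa [Matrix.kronecker_apply, Matrix.kronecker_apply, Matrix.single_apply_same, one_mul, one_mul] at h'
    have hCzero' : ∀ p q : Σ w, Fin 2 × Fin (m w), ¬(p.1 = q.1 ∧ p.2.1 = q.2.1) → C p q = 0 := by
      intro p q hpq
      have h := congrFun (congrFun (hCPw q.1 q.2.1) p) q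
      rw [hPw] at h
      dsimp only at h
      rw [Matrix.mul_diagonal, Matrix.diagonal_mul, if_pos ⟨rfl, rfl⟩, mul_one, if_neg hpq, zero_mul] at h
      exact h
    have hCzero : ∀ p q : Σ w, Fin 2 × Fin (m w), p.1 ≠ q.1 → C p q = 0 := fun p q hpq ↦
      hCzero' p q fun h ↦ hpq h.1
    set D : ∀ w, Matrix (Fin 2 × Fin (m w)) (Fin 2 × Fin (m w)) ℂ := fun w ↦ Matrix.blockDiag' C w with hD_def
    have hCeq : C = Matrix.blockDiagonal' D := eq_blockDiagonal'_blockDiag'_of_apply_eq_zero hCzero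
    have hDside : ∀ w (t t' : Fin 2 × Fin (m w)), t.1 ≠ t'.1 → D w t t' = 0 := by
      intro w t t' htt
      rw [hD_def]
      dsimp only
      rw [Matrix.blockDiag'_apply]
      exact hCzero' ⟨w, t⟩ ⟨w, t'⟩ fun h ↦ htt h.2
    -- the blocks preserve the pair Gram matrices
    have hsympC : Cᵀ * Hd * C = Hd := by
      rw [hB'eq, transpose_one_kronecker, one_kronecker_mul_one_kronecker, one_kronecker_mul_one_kronecker] at hsymp
      exact one_kronecker_injective d 0 hsymp
    have hblocks : ∀ w, (D w)ᵀ * Hb w * D w = Hb w := by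
      have h := hsympC
      rw [hCeq, hHdeq, Matrix.blockDiagonal'_transpose, ← Matrix.blockDiagonal'_mul, ← Matrix.blockDiagonal'_mul] at h
      exact fun w ↦ congrFun (Matrix.blockDiagonal'_injective h) w
    have hdet : ∀ w, (D w).det = 1 := fun w ↦
      det_eq_one_of_transpose_mul_mul_eq_complex (hHbt w) (hHbu w) (hblocks w)
    refine ⟨sigmaBlockDiagSL (fun w ↦ Fin 2 × Fin (m w)) ℂ fun w ↦ ⟨D w, hdet w⟩,
      Subgroup.mem_map.2 ⟨fun w ↦ ⟨D w, hdet w⟩, (Subgroup.mem_pi _).2 fun w _ ↦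
        (hKmem w _).2 ⟨hblocks w, hDside w⟩, rfl⟩, ?_⟩
    rw [hcoeB', coe_sigmaBlockDiagSL, hB'eq, hCeq]
  · -- `P · Δ_d(∏ U_w) · P⁻¹ ⊆ S(X)(ℂ)`
    rintro ⟨A, hA, hAeq⟩
    obtain ⟨Df, hDmem, rfl⟩ := Subgroup.mem_map.1 hA
    have hDK : ∀ w, (Df w).1ᵀ * Hb w * (Df w).1 = Hb w ∧
        ∀ t t' : Fin 2 × Fin (m w), t.1 ≠ t'.1 → (Df w).1 t t' = 0 :=
      fun w ↦ (hKmem w (Df w)).1 ((Subgroup.mem_pi _).1 hDmem w (Set.mem_univ w))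
    have hB' : B.submatrix eι eι = (1 : Matrix (Fin d) (Fin d) ℂ) ⊗ₖ Matrix.blockDiagonal' fun w ↦
        ((Df w : Matrix.SpecialLinearGroup (Fin 2 × Fin (m w)) ℂ) : Matrix (Fin 2 × Fin (m w)) (Fin 2 × Fin (m w)) ℂ) := by
      rw [← hcoeB', ← hAeq, coe_sigmaBlockDiagSL]
    refine ⟨?_, fun w s a b ↦ ?_⟩
    · rw [hB', transpose_one_kronecker, one_kronecker_mul_one_kronecker, one_kronecker_mul_one_kronecker, hHdeq,
        Matrix.blockDiagonal'_transpose, ← Matrix.blockDiagonal'_mul, ← Matrix.blockDiagonal'_mul]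
      exact congrArg _ (congrArg Matrix.blockDiagonal' (funext fun w ↦ (hDK w).1))
    · rw [hB', hUw, ← Matrix.mul_kronecker_mul, ← Matrix.mul_kronecker_mul, Matrix.one_mul, Matrix.mul_one]
      congr 1
      ext p q
      rw [hPw]
      dsimp only
      rw [Matrix.mul_diagonal, Matrix.diagonal_mul]
      by_cases hpq : p.1 = q.1
      · obtain ⟨w₁, t⟩ := p
        obtain ⟨w₂, t'⟩ := q
        dsimp only at hpq
        subst hpq
        rw [Matrix.blockDiagonal'_apply_eq]
        by_cases htt : t.1 = t'.1
        · rw [htt, mul_comm]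
        · rw [(hDK w₁).2 t t' htt, zero_mul, mul_zero]
      · obtain ⟨w₁, t⟩ := p
        obtain ⟨w₂, t'⟩ := q
        rw [Matrix.blockDiagonal'_apply_ne _ _ _ hpq, zero_mul, mul_zero]

/-- **`S(X)(ℂ)` IS CONNECTED FOR A COMPLETE FAMILY OF PAIRED `d × d` MATRIX-UNIT SYSTEMS WHOSE ADJOINTS SWAP THE
PAIRS** (Milne 1999, §2, «simple abelian variety of type IV» with Remark 2.2: `S(A)_{/k^al} ≅ ∏ GL`, acting on
`V_σ = V₁ ⊕ V₂` by the standard representation and its contragredient; Summary table «IV ∣ GL ∣ Connected: Yes»).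
Let `X = E/Φ(ℤ^ι)` be a complex torus, `G ∈ M_ι(ℚ)` alternating and non-degenerate, `d ≥ 1`, and
`e w s a b ∈ M_ι(ℂ)` (`w ∈ W` finite, `s ∈ {0,1}`, `a, b < d`) pairwise orthogonal `d × d` matrix-unit systems with
`Σ_w Σ_s Σ_a e w s a a = 1`, spanning the same `ℂ`-subspace as `End_ℚ(X)`, and with `(e w s a b)† = e w s̄ b a` for the
adjoint involution `A† = G_ℂ⁻¹ ᵗA G_ℂ`.  Then in the paired frame `P` (`exists_framePair`) an element of `S(X)(ℂ)` is
`P (1_d ⊗ diag_w C_w) P⁻¹` with `C_w` preserving the two corners of the pair and `ᵗC_w H_w C_w = H_w` for the pair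
Gram matrix `H_w` (alternating, invertible, zero on `V_{w,0} × V_{w,0}` and `V_{w,1} × V_{w,1}`), i.e.
`S(X)(ℂ) = P · Δ_d(∏_w U_w) · P⁻¹` with `U_w ≅ GL_{m_w}(ℂ)` the unitary-pair groups of `exists_subgroup_unitaryPair`
— so its complex vanishing ideal is prime. [cite: Milne1999LefschetzClasses, §2 Remark 2.2 (p. 647–648), «Simple abelian variety of type IV» (p. 651) and Summary table (p. 652)]
[cite: Springer1998, Exercise 2.2.2 (1), Thm. 1.5.4 (ii), Prop. 2.2.1] -/
theorem isPrime_vanishingIdealC_lefschetzGroupC_of_matrixUnitPairFamily {W : Type*} [Fintype W] [DecidableEq W]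
    {d : ℕ} [NeZero d] {G : Matrix ι ι ℚ} (hGt : Gᵀ = -G) (hGu : IsUnit G.det)
    {e : W → Fin 2 → Fin d → Fin d → Matrix ι ι ℂ}
    (hmul : ∀ (w w' : W) (s s' : Fin 2) (a b c d' : Fin d),
      e w s a b * e w' s' c d' = if w = w' ∧ s = s' ∧ b = c then e w s a d' else 0)
    (hone : ∑ w, ∑ s, ∑ a, e w s a a = 1)
    (hspan : ∀ w s a b,
      e w s a b ∈ Submodule.span ℂ ((fun A : Matrix ι ι ℚ ↦ A.map (algebraMap ℚ ℂ)) '' (endAlgRat Φ : Set (Matrix ι ι ℚ))))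
    (habs : ∀ A ∈ endAlgRat Φ, A.map (algebraMap ℚ ℂ) ∈
      Submodule.span ℂ (Set.range fun p : W × Fin 2 × Fin d × Fin d ↦ e p.1 p.2.1 p.2.2.1 p.2.2.2))
    (hadj : ∀ w s a b, rosati (G.map (algebraMap ℚ ℂ)) (e w s a b) = e w s.rev b a) :
    (vanishingIdealC (lefschetzGroupC Φ G)).IsPrime := by
  classical
  obtain ⟨m, eι, P, hP, Hb, K, -, -, -, -, hKc, hKp, -, hS⟩ :=
    exists_frame_lefschetzGroupC_eq_conj_diagPow_pi_of_matrixUnitPairFamily Φ hGt hGu hmul hone hspan habs hadj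
  rw [hS]
  exact isPrime_vanishingIdealC_map_conjGLC hP (isPrime_vanishingIdealC_map_reindexSLC eι
    (isPrime_vanishingIdealC_map_diagPowSLC (isPrime_vanishingIdealC_sigmaPi_map hKc hKp)))

/-- **`Lf(X)(ℂ) = S(X)(ℂ)` for a complete family of paired `d × d` matrix-unit systems whose adjoints swap the pairs**
(hypotheses of `isPrime_vanishingIdealC_lefschetzGroupC_of_matrixUnitPairFamily`): Lange's identity component is all
of Milne's `S(X)` — «IV ∣ GL ∣ Semisimple: No ∣ Connected: Yes».
[cite: Milne1999LefschetzClasses, §2 «Simple abelian variety of type IV» (p. 651) and Summary table (p. 652)]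
[cite: Lange2023AbelianVarietiesComplex, §7.2.4 Exercise (4)] -/
theorem lefschetzIdentityC_eq_lefschetzGroupC_of_matrixUnitPairFamily {W : Type*} [Fintype W] [DecidableEq W]
    {d : ℕ} [NeZero d] {G : Matrix ι ι ℚ} (hGt : Gᵀ = -G) (hGu : IsUnit G.det)
    {e : W → Fin 2 → Fin d → Fin d → Matrix ι ι ℂ}
    (hmul : ∀ (w w' : W) (s s' : Fin 2) (a b c d' : Fin d),
      e w s a b * e w' s' c d' = if w = w' ∧ s = s' ∧ b = c then e w s a d' else 0)
    (hone : ∑ w, ∑ s, ∑ a, e w s a a = 1)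
    (hspan : ∀ w s a b,
      e w s a b ∈ Submodule.span ℂ ((fun A : Matrix ι ι ℚ ↦ A.map (algebraMap ℚ ℂ)) '' (endAlgRat Φ : Set (Matrix ι ι ℚ))))
    (habs : ∀ A ∈ endAlgRat Φ, A.map (algebraMap ℚ ℂ) ∈
      Submodule.span ℂ (Set.range fun p : W × Fin 2 × Fin d × Fin d ↦ e p.1 p.2.1 p.2.2.1 p.2.2.2))
    (hadj : ∀ w s a b, rosati (G.map (algebraMap ℚ ℂ)) (e w s a b) = e w s.rev b a) :
    lefschetzIdentityC Φ G = lefschetzGroupC Φ G :=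
  lefschetzIdentityC_eq_of_isPrime Φ
    (isPrime_vanishingIdealC_lefschetzGroupC_of_matrixUnitPairFamily Φ hGt hGu hmul hone hspan habs hadj)

end MainPair

end ComplexTorus

end Literature.Geometry.Kaehler

end
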